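/-
Copyright (c) 2026 the pub-hodgecm-mathlib formalisation cell (harness21).  Prover seat hodgecm-mathlib-K2Liu-p05 (g4), 2026-09-04
(Track B «K2-LIT», crux hLiu418 = stmt-HodgeConjecture-24832, LEAD F0P6-plan (g13) RULING M-157m (1) organ (SD-1-ind), file (I):
the EXPLICIT Iwasawa decomposition of the Weyl translate `w_Δ · n(b)` in the tube frame, with RATIONAL letters `(1 ± i b)⁻¹`).
-/
import Summits.HodgeConjecture.HodgeConjecture.Theorems.K2LiuArchInducedTubeDefs      -- ★ (D∞) K2Liu-p11: `IsArchSiegelSection`, tube frame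
import Summits.HodgeConjecture.HodgeConjecture.Theorems.K2LiuHermitianTubeAction       -- ★ H1-B: `transl_mem_iff`, `levi_mem_iff`, `mul_mem_UJ`
import HarnessLib

/-!
# (SD-1-ind, I) The Weyl translate `J · transl b = p(b) · k(b)`: an explicit Siegel-parabolic × stabiliser factorisation with letters `(1 ± i b)⁻¹`

Track B ∕ K2-LIT, hLiu418 = stmt-HodgeConjecture-24832; LEAD F0P6-plan (g13) RULING M-157m (1) «(SD-1-ind): for a `K_∞`-finite flat section of `I_σ(s)`,
`f_s(w·n(b)) = Σ_j P_j((1−2ib)⁻¹, (1+2ib)⁻¹ entries)·det(1−2ib)^{−α_j}det(1+2ib)^{−β_j}`».  Namespace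
`Summit.HodgeConjecture.HodgeConjecture.Cruxes.HLiu418.K2LiuWeylTranslateIwasawa`.  THEOREMS ONLY (no definition, no instance, no notation, no named fact,
no `sorry`); `--supports stmt-HodgeConjecture-24832 --as helper`.

THE FACTORISATION (tube frame of ★ `K2LiuHermitianTubeCocycle` ∕ ★ `K2LiuArchInducedTubeDefs`: `J = (0 −1; 1 0)`, `transl b = (1 b; 0 1)`, Levi `(a 0; 0 d)` with `aᴴd = 1`).
For a hermitian `b` put `M = 1 + b² = (1 + ib)(1 − ib)` (positive definite, `isUnit_det_one_add_mul_self`), `e = M⁻¹`, and the RATIONAL letters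
`(1 + ib)⁻¹ = (1 − ib)·e`, `(1 − ib)⁻¹ = (1 + ib)·e`.  Then (`J_mul_transl_eq`)
  `J · transl b = p(b) · k(b)`,  `p(b) = ((1+ib)e, −b e (1+ib); 0, 1+ib) = transl (−b e) · levi ((1+ib)e, 1+ib) ∈ U(J) ∩ P_Δ`
  (`p_eq_transl_mul_levi`, `p_mem`, Levi block `A_p = (1 − ib)⁻¹`), `k(b) = (b c, −c; c, c b)`, `c = (1 − ib) e = (1 + ib)⁻¹` — whose Cayley letters are
  `A − iC = −i·1` (constant) and `A + iC = i(2c − 1)` (`cayley_letters`): LINEAR in the entries of `(1 + ib)⁻¹`.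
Since `J · transl b`, `p(b) ∈ U(J)`, the factor `k(b) = p(b)⁻¹ J transl b` lies in `U(J)` and fixes `i·1`, i.e. `k(b) ∈ K_w` (sequel (III), with the parabolic
law ★ `IsArchSiegelSection`: `f (J · transl b) = χ(det (1 − ib)⁻¹) · ‖det (1 − ib)⁻¹‖^{2s+l} · f (k(b))`, `f (k(b))` polynomial in the entries of `(1 ± ib)⁻¹` by
★ `exists_mvPolynomial_of_finiteDimensional_span_rightTranslates`).

HONEST LABEL: HC_CM is proved only modulo the 7 printed citations (2 remaining named inputs: hLiu418 = stmt-HodgeConjecture-24832, h413 =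
stmt-HodgeConjecture-24833) until rung 0 closes; organ capital, moves no counter.

## References
[Shimura1997] G. Shimura, *Euler Products and Eisenstein Series*, CBMS 93 (1997), §§5–6, §16 · G. Shimura, *Confluent hypergeometric functions on tube
domains*, Math. Ann. 260 (1982), §3 (the Weyl translate under the Gindikin–Shimura integrals).
-/

set_option autoImplicit false
set_option linter.dupNamespace false

noncomputable section

open scoped Matrix ComplexConjugate ComplexOrder MatrixOrder
open Complex Matrix
open Literature.NumberTheory.ModularForms.SiegelUpperHalfSpace (moeb)
open Summit.HodgeConjecture.HodgeConjecture.Cruxes.HLiu418.K2LiuHermitianTubeCocycle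
open Summit.HodgeConjecture.HodgeConjecture.Cruxes.HLiu418.K2LiuHermitianTubeAction

namespace Summit.HodgeConjecture.HodgeConjecture.Cruxes.HLiu418.K2LiuWeylTranslateIwasawa

variable {l : Type*} [Fintype l] [DecidableEq l]

/-! ## §1 The letters: `1 + b²` is invertible, `b` and `(1 + b²)⁻¹` commute, `(1 ± ib)(1 ∓ ib) = 1 + b²` -/

/-- `(1 + ib)(1 − ib) = 1 + b²`. [folklore] -/
theorem one_add_mul_one_sub (b : Matrix l l ℂ) : (1 + I • b) * (1 - I • b) = 1 + b * b := by
  rw [add_mul, mul_sub, mul_sub, one_mul, one_mul, mul_one, Matrix.smul_mul, Matrix.mul_smul, smul_smul, Complex.I_mul_I, neg_one_smul]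
  abel

/-- `(1 − ib)(1 + ib) = 1 + b²`. [folklore] -/
theorem one_sub_mul_one_add (b : Matrix l l ℂ) : (1 - I • b) * (1 + I • b) = 1 + b * b := by
  rw [sub_mul, mul_add, mul_add, one_mul, one_mul, mul_one, Matrix.smul_mul, Matrix.mul_smul, smul_smul, Complex.I_mul_I, neg_one_smul]
  abel

/-- for hermitian `b`, `1 + b² = 1 + bᴴb` is positive definite. [folklore] -/
theorem posDef_one_add_mul_self {b : Matrix l l ℂ} (hb : bᴴ = b) : (1 + b * b).PosDef := by
  have h := PosDef.one.add_posSemidef (posSemidef_conjTranspose_mul_self b)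
  rwa [hb] at h

/-- hence `det (1 + b²) ≠ 0`. [folklore] -/
theorem isUnit_det_one_add_mul_self {b : Matrix l l ℂ} (hb : bᴴ = b) : IsUnit (1 + b * b).det :=
  (Matrix.isUnit_iff_isUnit_det _).1 (posDef_one_add_mul_self hb).isUnit

/-- `b` commutes with `(1 + b²)⁻¹`. [folklore] -/
theorem mul_inv_one_add_mul_self_comm {b : Matrix l l ℂ} (hb : bᴴ = b) : b * (1 + b * b)⁻¹ = (1 + b * b)⁻¹ * b := by
  have hu := isUnit_det_one_add_mul_self hb
  have hbM : b * (1 + b * b) = (1 + b * b) * b := by noncomm_ring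
  calc b * (1 + b * b)⁻¹ = (1 + b * b)⁻¹ * (1 + b * b) * b * (1 + b * b)⁻¹ := by rw [nonsing_inv_mul _ hu, Matrix.one_mul]
    _ = (1 + b * b)⁻¹ * (b * (1 + b * b)) * (1 + b * b)⁻¹ := by rw [hbM, Matrix.mul_assoc ((1 + b * b)⁻¹)]
    _ = (1 + b * b)⁻¹ * b * ((1 + b * b) * (1 + b * b)⁻¹) := by simp only [Matrix.mul_assoc]
    _ = (1 + b * b)⁻¹ * b := by rw [mul_nonsing_inv _ hu, Matrix.mul_one]

/-- **the rational letters**: `(1 + ib) · ((1 − ib)(1 + b²)⁻¹) = 1` — i.e. `(1 + ib)⁻¹ = (1 − ib)(1 + b²)⁻¹`. [folklore] -/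
theorem one_add_mul_letter {b : Matrix l l ℂ} (hb : bᴴ = b) : (1 + I • b) * ((1 - I • b) * (1 + b * b)⁻¹) = 1 := by
  rw [← Matrix.mul_assoc, one_add_mul_one_sub, mul_nonsing_inv _ (isUnit_det_one_add_mul_self hb)]

/-- `(1 − ib) · ((1 + ib)(1 + b²)⁻¹) = 1` — i.e. `(1 − ib)⁻¹ = (1 + ib)(1 + b²)⁻¹`. [folklore] -/
theorem one_sub_mul_letter {b : Matrix l l ℂ} (hb : bᴴ = b) : (1 - I • b) * ((1 + I • b) * (1 + b * b)⁻¹) = 1 := by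
  rw [← Matrix.mul_assoc, one_sub_mul_one_add, mul_nonsing_inv _ (isUnit_det_one_add_mul_self hb)]

/-- so `det (1 + ib) ≠ 0`. [folklore] -/
theorem isUnit_det_one_add_I_smul {b : Matrix l l ℂ} (hb : bᴴ = b) : IsUnit (1 + I • b).det :=
  isUnit_det_of_right_inverse (one_add_mul_letter hb)

/-- and `det (1 − ib) ≠ 0`. [folklore] -/
theorem isUnit_det_one_sub_I_smul {b : Matrix l l ℂ} (hb : bᴴ = b) : IsUnit (1 - I • b).det :=
  isUnit_det_of_right_inverse (one_sub_mul_letter hb)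

/-- `(1 + ib)⁻¹ = (1 − ib)(1 + b²)⁻¹`. [folklore] -/
theorem inv_one_add_I_smul {b : Matrix l l ℂ} (hb : bᴴ = b) : (1 + I • b)⁻¹ = (1 - I • b) * (1 + b * b)⁻¹ :=
  inv_eq_right_inv (one_add_mul_letter hb)

/-- `(1 − ib)⁻¹ = (1 + ib)(1 + b²)⁻¹`. [folklore] -/
theorem inv_one_sub_I_smul {b : Matrix l l ℂ} (hb : bᴴ = b) : (1 - I • b)⁻¹ = (1 + I • b) * (1 + b * b)⁻¹ :=
  inv_eq_right_inv (one_sub_mul_letter hb)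

/-! ## §2 The factorisation `J · transl b = p(b) · k(b)` -/

/-- **THE EXPLICIT IWASAWA DECOMPOSITION OF THE WEYL TRANSLATE**: with `e = (1 + b²)⁻¹`,
`J · transl b = ((1+ib)e, −(b e)(1+ib); 0, 1+ib) · (b((1−ib)e), −(1−ib)e; (1−ib)e, ((1−ib)e)b)` for every hermitian `b`
(block algebra in the commutative family `b, e, 1 ± ib`). [cite: Shimura1997, §6.4] (cf. Shimura, Math. Ann. 260 (1982), §3) -/
theorem J_mul_transl_eq {b : Matrix l l ℂ} (hb : bᴴ = b) :
    Matrix.J l ℂ * fromBlocks 1 b 0 1 =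
      fromBlocks ((1 + I • b) * (1 + b * b)⁻¹) (-(b * (1 + b * b)⁻¹) * (1 + I • b)) 0 (1 + I • b) *
        fromBlocks (b * ((1 - I • b) * (1 + b * b)⁻¹)) (-((1 - I • b) * (1 + b * b)⁻¹)) ((1 - I • b) * (1 + b * b)⁻¹)
          ((1 - I • b) * (1 + b * b)⁻¹ * b) := by
  have hu := isUnit_det_one_add_mul_self hb
  -- the commutative calculus of the letters
  have he : (1 + b * b) * (1 + b * b)⁻¹ = 1 := mul_nonsing_inv _ hu
  have he' : (1 + b * b)⁻¹ * (1 + b * b) = 1 := nonsing_inv_mul _ hu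
  have hbe : b * (1 + b * b)⁻¹ = (1 + b * b)⁻¹ * b := mul_inv_one_add_mul_self_comm hb
  have hle : (1 - I • b) * (1 + b * b)⁻¹ = (1 + b * b)⁻¹ * (1 - I • b) := by
    rw [sub_mul, mul_sub, one_mul, mul_one, Matrix.smul_mul, Matrix.mul_smul, hbe]
  have hpe : (1 + I • b) * (1 + b * b)⁻¹ = (1 + b * b)⁻¹ * (1 + I • b) := by
    rw [add_mul, mul_add, one_mul, mul_one, Matrix.smul_mul, Matrix.mul_smul, hbe]
  have hbl : b * (1 - I • b) = (1 - I • b) * b := by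
    rw [mul_sub, sub_mul, mul_one, one_mul, Matrix.smul_mul, Matrix.mul_smul]
  -- `d c = 1`
  have hdc : (1 + I • b) * ((1 - I • b) * (1 + b * b)⁻¹) = 1 := one_add_mul_letter hb
  have hbM : b * (1 + b * b) = (1 + b * b) * b := by noncomm_ring
  -- the products of letters that occur
  have h11a : (1 + I • b) * (1 + b * b)⁻¹ * (b * ((1 - I • b) * (1 + b * b)⁻¹)) = b * (1 + b * b)⁻¹ := by
    simp only [← Matrix.mul_assoc]
    rw [Matrix.mul_assoc (1 + I • b) (1 + b * b)⁻¹ b, ← hbe, Matrix.mul_assoc (1 + I • b) (b * (1 + b * b)⁻¹) (1 - I • b),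
      Matrix.mul_assoc b (1 + b * b)⁻¹ (1 - I • b), ← hle, ← Matrix.mul_assoc b (1 - I • b) (1 + b * b)⁻¹, hbl]
    simp only [← Matrix.mul_assoc]
    rw [one_add_mul_one_sub, ← hbM, Matrix.mul_assoc b (1 + b * b) (1 + b * b)⁻¹, he, Matrix.mul_one]
  have h12a : (1 + I • b) * (1 + b * b)⁻¹ * ((1 - I • b) * (1 + b * b)⁻¹) = (1 + b * b)⁻¹ := by
    simp only [← Matrix.mul_assoc]
    rw [Matrix.mul_assoc (1 + I • b) (1 + b * b)⁻¹ (1 - I • b), ← hle, ← Matrix.mul_assoc (1 + I • b) (1 - I • b) (1 + b * b)⁻¹,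
      one_add_mul_one_sub, he, Matrix.one_mul]
  have h12b : -(b * (1 + b * b)⁻¹) * (1 + I • b) * ((1 - I • b) * (1 + b * b)⁻¹ * b) = -((1 + b * b)⁻¹ * (b * b)) := by
    rw [← Matrix.mul_assoc _ ((1 - I • b) * (1 + b * b)⁻¹) b, Matrix.mul_assoc (-(b * (1 + b * b)⁻¹)) (1 + I • b), hdc, Matrix.mul_one,
      Matrix.neg_mul, hbe, Matrix.mul_assoc]
  have hsum : (1 + b * b)⁻¹ + (1 + b * b)⁻¹ * (b * b) = 1 := by
    calc (1 + b * b)⁻¹ + (1 + b * b)⁻¹ * (b * b) = (1 + b * b)⁻¹ * 1 + (1 + b * b)⁻¹ * (b * b) := by rw [Matrix.mul_one]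
      _ = (1 + b * b)⁻¹ * (1 + b * b) := by rw [Matrix.mul_add]
      _ = 1 := he'
  -- the left-hand side
  have hJ : Matrix.J l ℂ * fromBlocks 1 b 0 1 = fromBlocks 0 (-1) 1 b := by
    rw [Matrix.J, fromBlocks_multiply]
    simp only [Matrix.zero_mul, Matrix.one_mul, Matrix.mul_zero, zero_add, add_zero, Matrix.mul_one]
  rw [hJ, fromBlocks_multiply]
  refine fromBlocks_inj.2 ⟨?_, ?_, ?_, ?_⟩
  · -- `a (b c) + (X d) c = 0`
    rw [h11a, Matrix.mul_assoc (-(b * (1 + b * b)⁻¹)) (1 + I • b), hdc, Matrix.mul_one, add_neg_cancel]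
  · -- `−a c + (X d)(c b) = −1`
    rw [Matrix.mul_neg, h12a, h12b, ← neg_add, hsum]
  · -- `d c = 1`
    rw [Matrix.zero_mul, zero_add, hdc]
  · -- `d (c b) = b`
    rw [Matrix.zero_mul, zero_add, ← Matrix.mul_assoc, hdc, Matrix.one_mul]

/-! ## §3 The parabolic factor `p(b) ∈ U(J) ∩ P_Δ`, the stabiliser factor `k(b) ∈ K_w`, the parabolic law, the Cayley letters -/

omit [Fintype l] in
/-- `(1 + ib)ᴴ = 1 − ib` for hermitian `b`. [folklore] -/
theorem conjTranspose_one_add_I_smul {b : Matrix l l ℂ} (hb : bᴴ = b) : (1 + I • b)ᴴ = 1 - I • b := by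
  rw [conjTranspose_add, conjTranspose_one, conjTranspose_smul, hb, star_def, conj_I, neg_smul, sub_eq_add_neg]

omit [Fintype l] in
/-- `(1 − ib)ᴴ = 1 + ib` for hermitian `b`. [folklore] -/
theorem conjTranspose_one_sub_I_smul {b : Matrix l l ℂ} (hb : bᴴ = b) : (1 - I • b)ᴴ = 1 + I • b := by
  rw [conjTranspose_sub, conjTranspose_one, conjTranspose_smul, hb, star_def, conj_I, neg_smul, sub_neg_eq_add]

/-- `(1 + b²)⁻¹` is hermitian. [folklore] -/
theorem conjTranspose_inv_one_add_mul_self {b : Matrix l l ℂ} (hb : bᴴ = b) : ((1 + b * b)⁻¹)ᴴ = (1 + b * b)⁻¹ := by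
  rw [conjTranspose_nonsing_inv, conjTranspose_add, conjTranspose_one, conjTranspose_mul, hb]

/-- the parabolic factor is `transl (−b e) · levi ((1+ib)e, 1+ib)`. [cite: Shimura1997, §6.4] -/
theorem parabolicFactor_eq (b : Matrix l l ℂ) :
    (fromBlocks ((1 + I • b) * (1 + b * b)⁻¹) (-(b * (1 + b * b)⁻¹) * (1 + I • b)) 0 (1 + I • b) : Matrix (l ⊕ l) (l ⊕ l) ℂ) =
      fromBlocks 1 (-(b * (1 + b * b)⁻¹)) 0 1 * fromBlocks ((1 + I • b) * (1 + b * b)⁻¹) 0 0 (1 + I • b) := by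
  rw [fromBlocks_multiply]
  simp only [Matrix.one_mul, Matrix.mul_zero, Matrix.zero_mul, add_zero, zero_add]

/-- **the parabolic factor lies in `U(J)`** (`aᴴ d = e (1 − ib)(1 + ib) = 1`). [cite: Shimura1997, §5.1, §6.4] -/
theorem parabolicFactor_mem {b : Matrix l l ℂ} (hb : bᴴ = b) :
    (fromBlocks ((1 + I • b) * (1 + b * b)⁻¹) (-(b * (1 + b * b)⁻¹) * (1 + I • b)) 0 (1 + I • b) : Matrix (l ⊕ l) (l ⊕ l) ℂ)ᴴ *
        Matrix.J l ℂ * fromBlocks ((1 + I • b) * (1 + b * b)⁻¹) (-(b * (1 + b * b)⁻¹) * (1 + I • b)) 0 (1 + I • b) = Matrix.J l ℂ := by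
  rw [parabolicFactor_eq]
  refine mul_mem_UJ ((transl_mem_iff _).2 ?_) ((levi_mem_iff _ _).2 ?_)
  · rw [conjTranspose_neg, conjTranspose_mul, hb, conjTranspose_inv_one_add_mul_self hb, mul_inv_one_add_mul_self_comm hb]
  · rw [conjTranspose_mul, conjTranspose_inv_one_add_mul_self hb, conjTranspose_one_add_I_smul hb, Matrix.mul_assoc, one_sub_mul_one_add,
      nonsing_inv_mul _ (isUnit_det_one_add_mul_self hb)]

/-- it lies in the Siegel parabolic: lower-left block `0` … [cite: Shimura1997, §6.4] -/
theorem parabolicFactor_toBlocks₂₁ (b : Matrix l l ℂ) :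
    (fromBlocks ((1 + I • b) * (1 + b * b)⁻¹) (-(b * (1 + b * b)⁻¹) * (1 + I • b)) 0 (1 + I • b) : Matrix (l ⊕ l) (l ⊕ l) ℂ).toBlocks₂₁ = 0 :=
  toBlocks_fromBlocks₂₁ _ _ _ _

/-- … and Levi block `A_p = (1 + ib) e = (1 − ib)⁻¹`. [cite: Shimura1997, §6.4] -/
theorem parabolicFactor_toBlocks₁₁ {b : Matrix l l ℂ} (hb : bᴴ = b) :
    (fromBlocks ((1 + I • b) * (1 + b * b)⁻¹) (-(b * (1 + b * b)⁻¹) * (1 + I • b)) 0 (1 + I • b) : Matrix (l ⊕ l) (l ⊕ l) ℂ).toBlocks₁₁ =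
      (1 - I • b)⁻¹ := by
  rw [toBlocks_fromBlocks₁₁, inv_one_sub_I_smul hb]

/-- the explicit inverse of the parabolic factor: `levi (1 − ib, (1−ib)e) · transl (b e) = (1 − ib, (1 − ib) b e; 0, (1 − ib) e)`. [folklore] -/
theorem parabolicInv_eq (b : Matrix l l ℂ) :
    (fromBlocks (1 - I • b) 0 0 ((1 - I • b) * (1 + b * b)⁻¹) * fromBlocks 1 (b * (1 + b * b)⁻¹) 0 1 : Matrix (l ⊕ l) (l ⊕ l) ℂ) =
      fromBlocks (1 - I • b) ((1 - I • b) * (b * (1 + b * b)⁻¹)) 0 ((1 - I • b) * (1 + b * b)⁻¹) := by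
  rw [fromBlocks_multiply]
  simp only [Matrix.mul_one, Matrix.mul_zero, Matrix.zero_mul, add_zero, zero_add]

/-- `p(b)⁻¹ · p(b) = 1` with `p(b)⁻¹ = (1 − ib, (1 − ib) b e; 0, (1 − ib) e)`. [folklore] -/
theorem parabolicInv_mul_parabolicFactor {b : Matrix l l ℂ} (hb : bᴴ = b) :
    (fromBlocks (1 - I • b) ((1 - I • b) * (b * (1 + b * b)⁻¹)) 0 ((1 - I • b) * (1 + b * b)⁻¹) : Matrix (l ⊕ l) (l ⊕ l) ℂ) *
        fromBlocks ((1 + I • b) * (1 + b * b)⁻¹) (-(b * (1 + b * b)⁻¹) * (1 + I • b)) 0 (1 + I • b) = 1 := by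
  have hle : (1 - I • b) * (1 + b * b)⁻¹ = (1 + b * b)⁻¹ * (1 - I • b) := by
    rw [sub_mul, mul_sub, one_mul, mul_one, Matrix.smul_mul, Matrix.mul_smul, mul_inv_one_add_mul_self_comm hb]
  rw [fromBlocks_multiply, ← fromBlocks_one]
  refine fromBlocks_inj.2 ⟨?_, ?_, ?_, ?_⟩
  · rw [Matrix.mul_zero, add_zero, one_sub_mul_letter hb]
  · simp only [Matrix.neg_mul, Matrix.mul_neg, Matrix.mul_assoc, neg_add_cancel]
  · rw [Matrix.zero_mul, Matrix.mul_zero, add_zero]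
  · rw [Matrix.zero_mul, zero_add, hle, Matrix.mul_assoc, one_sub_mul_one_add, nonsing_inv_mul _ (isUnit_det_one_add_mul_self hb)]

/-- `p(b)⁻¹ ∈ U(J)`. [cite: Shimura1997, §5.1] -/
theorem parabolicInv_mem {b : Matrix l l ℂ} (hb : bᴴ = b) :
    (fromBlocks (1 - I • b) ((1 - I • b) * (b * (1 + b * b)⁻¹)) 0 ((1 - I • b) * (1 + b * b)⁻¹) : Matrix (l ⊕ l) (l ⊕ l) ℂ)ᴴ * Matrix.J l ℂ *
        fromBlocks (1 - I • b) ((1 - I • b) * (b * (1 + b * b)⁻¹)) 0 ((1 - I • b) * (1 + b * b)⁻¹) = Matrix.J l ℂ := by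
  rw [← parabolicInv_eq]
  refine mul_mem_UJ ((levi_mem_iff _ _).2 ?_) ((transl_mem_iff _).2 ?_)
  · rw [conjTranspose_one_sub_I_smul hb, one_add_mul_letter hb]
  · rw [conjTranspose_mul, hb, conjTranspose_inv_one_add_mul_self hb, mul_inv_one_add_mul_self_comm hb]

/-- **the stabiliser factor is `p(b)⁻¹ · J · transl b`**. [cite: Shimura1997, §6.4] -/
theorem stabFactor_eq {b : Matrix l l ℂ} (hb : bᴴ = b) :
    (fromBlocks (b * ((1 - I • b) * (1 + b * b)⁻¹)) (-((1 - I • b) * (1 + b * b)⁻¹)) ((1 - I • b) * (1 + b * b)⁻¹)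
        ((1 - I • b) * (1 + b * b)⁻¹ * b) : Matrix (l ⊕ l) (l ⊕ l) ℂ) =
      fromBlocks (1 - I • b) ((1 - I • b) * (b * (1 + b * b)⁻¹)) 0 ((1 - I • b) * (1 + b * b)⁻¹) * (Matrix.J l ℂ * fromBlocks 1 b 0 1) := by
  rw [J_mul_transl_eq hb, ← Matrix.mul_assoc (fromBlocks (1 - I • b) ((1 - I • b) * (b * (1 + b * b)⁻¹)) 0 ((1 - I • b) * (1 + b * b)⁻¹)),
    parabolicInv_mul_parabolicFactor hb, Matrix.one_mul]

/-- **the stabiliser factor lies in `U(J)`**. [cite: Shimura1997, §5.1] -/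
theorem stabFactor_mem {b : Matrix l l ℂ} (hb : bᴴ = b) :
    (fromBlocks (b * ((1 - I • b) * (1 + b * b)⁻¹)) (-((1 - I • b) * (1 + b * b)⁻¹)) ((1 - I • b) * (1 + b * b)⁻¹)
        ((1 - I • b) * (1 + b * b)⁻¹ * b) : Matrix (l ⊕ l) (l ⊕ l) ℂ)ᴴ * Matrix.J l ℂ *
      fromBlocks (b * ((1 - I • b) * (1 + b * b)⁻¹)) (-((1 - I • b) * (1 + b * b)⁻¹)) ((1 - I • b) * (1 + b * b)⁻¹)
        ((1 - I • b) * (1 + b * b)⁻¹ * b) = Matrix.J l ℂ := by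
  rw [stabFactor_eq hb]
  exact mul_mem_UJ (parabolicInv_mem hb) (mul_mem_UJ J_mem ((transl_mem_iff b).2 hb))

/-- `b` commutes with `c = (1 − ib) e`. [folklore] -/
theorem mul_letter_comm {b : Matrix l l ℂ} (hb : bᴴ = b) :
    b * ((1 - I • b) * (1 + b * b)⁻¹) = (1 - I • b) * (1 + b * b)⁻¹ * b := by
  have hbl : b * (1 - I • b) = (1 - I • b) * b := by
    rw [mul_sub, sub_mul, mul_one, one_mul, Matrix.smul_mul, Matrix.mul_smul]
  rw [← Matrix.mul_assoc, hbl, Matrix.mul_assoc, mul_inv_one_add_mul_self_comm hb, Matrix.mul_assoc]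

/-- **the stabiliser factor fixes the base point `i·1`**, i.e. `k(b) ∈ K_w = Stab(i1)` (stabiliser equation `iA + B = −C + iD` with
`A = b c = c b = D`, `B = −c = −C`). [cite: Shimura1997, §6.5] -/
theorem moeb_stabFactor_I {b : Matrix l l ℂ} (hb : bᴴ = b) :
    moeb (fromBlocks (b * ((1 - I • b) * (1 + b * b)⁻¹)) (-((1 - I • b) * (1 + b * b)⁻¹)) ((1 - I • b) * (1 + b * b)⁻¹)
        ((1 - I • b) * (1 + b * b)⁻¹ * b)) (I • (1 : Matrix l l ℂ)) = I • 1 := by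
  rw [moeb_I_eq_I_iff (stabFactor_mem hb), toBlocks_fromBlocks₁₁, toBlocks_fromBlocks₁₂, toBlocks_fromBlocks₂₁, toBlocks_fromBlocks₂₂,
    mul_letter_comm hb, ← sub_eq_add_neg, ← sub_eq_neg_add]

/-- **THE PARABOLIC LAW AT THE WEYL TRANSLATE**: for a Siegel section `f` of `I_w(s, χ)` and hermitian `b`,
`f (J · transl b) = χ(det (1 − ib)⁻¹) · ‖det (1 − ib)⁻¹‖^{2s + l} · f (k(b))`. [cite: Shimura1997, §16.4] (cf. Shimura, Math. Ann. 260 (1982), §3) -/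
theorem section_J_mul_transl {χ : ℂ → ℂ} {s : ℂ} {f : Matrix (l ⊕ l) (l ⊕ l) ℂ → ℂ}
    (hf : K2LiuArchInducedTubeDefs.IsArchSiegelSection χ s f) {b : Matrix l l ℂ} (hb : bᴴ = b) :
    f (Matrix.J l ℂ * fromBlocks 1 b 0 1) =
      χ (1 - I • b)⁻¹.det * (((‖(1 - I • b)⁻¹.det‖ : ℝ) : ℂ) ^ (2 * s + (Fintype.card l : ℂ))) *
        f (fromBlocks (b * ((1 - I • b) * (1 + b * b)⁻¹)) (-((1 - I • b) * (1 + b * b)⁻¹)) ((1 - I • b) * (1 + b * b)⁻¹)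
          ((1 - I • b) * (1 + b * b)⁻¹ * b)) := by
  rw [J_mul_transl_eq hb, hf _ _ (parabolicFactor_mem hb) (parabolicFactor_toBlocks₂₁ b), parabolicFactor_toBlocks₁₁ hb]

/-- **THE CAYLEY LETTERS OF THE STABILISER FACTOR** `k(b) = (A B; C D)`, `A = b c`, `C = c`, `c = (1 + ib)⁻¹`:
`A − iC = −i·1` (constant) and `A + iC = i(2c − 1)` — linear in the entries of `(1 + ib)⁻¹`. [cite: Shimura1997, §6.5] -/
theorem stabFactor_cayley_letters {b : Matrix l l ℂ} (hb : bᴴ = b) :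
    b * ((1 - I • b) * (1 + b * b)⁻¹) - I • ((1 - I • b) * (1 + b * b)⁻¹) = (-I) • (1 : Matrix l l ℂ) ∧
      b * ((1 - I • b) * (1 + b * b)⁻¹) + I • ((1 - I • b) * (1 + b * b)⁻¹) = I • ((2 : ℂ) • ((1 - I • b) * (1 + b * b)⁻¹) - 1) := by
  have hdc : (1 + I • b) * ((1 - I • b) * (1 + b * b)⁻¹) = 1 := one_add_mul_letter hb
  generalize (1 - I • b) * (1 + b * b)⁻¹ = c at hdc ⊢
  constructor
  · -- `(b − i)c = −i (1 + ib) c = −i`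
    have h : (-I) • ((1 + I • b) * c) = b * c - I • c := by
      rw [add_mul, Matrix.one_mul, Matrix.smul_mul, smul_add, smul_smul, neg_mul, I_mul_I, neg_neg, one_smul, neg_smul]
      abel
    rw [← h, hdc]
  · -- `(b + i)c = i (c − i b c) = i (2c − (1 + ib)c) = i (2c − 1)`
    rw [show (2 : ℂ) • c = c + c from two_smul ℂ c, ← hdc, add_mul, Matrix.one_mul, Matrix.smul_mul, smul_sub,
      smul_add (I : ℂ) c (I • (b * c)), smul_add, smul_smul, I_mul_I, neg_one_smul]
    abel

end Summit.HodgeConjecture.HodgeConjecture.Cruxes.HLiu418.K2LiuWeylTranslateIwasawa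

end
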